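import Mathlib.Analysis.SpecialFunctions.Trigonometric.Inverse
import Mathlib.Analysis.SpecialFunctions.Sqrt
import Mathlib.Algebra.BigOperators.Fin
import Literature.MathematicalPhysics.QuantumLattice.HubbardFermiCurve
import HarnessLib

/-!
# Sharp umklapp thresholds on the square-lattice Fermi curve, and the periodic caustic chain at `μ = -1`

Soloist `solo-HubbardSuperconductivity-informed`, sharpest-statement memo §2d (1) and (3)(iv′).
Companion to `SoloInformedUmklappCaustic.lean` (Proposition U).  Tree convention:
`ε(k) = -2(cos k₁ + cos k₂)` (`sqDispersion`), Brillouin zone `|kᵢ| ≤ π`, hole-doped side `μ ≤ 0`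
(`μ = 2 μ_BGM - 4` against the convention `ε = 2 - cos k₁ - cos k₂` of Benfatto–Giuliani–Mastropietro).

## 1. Thresholds (memo §2d (1), previously prose arithmetic; here kernel facts)

For `n ≥ 1` and `μ ≤ 0`:  `2n` Fermi momenta of the level `{ε = μ}` inside the zone can sum to a
NON-ZERO reciprocal-lattice vector `2πG`, `G ∈ ℤ² ∖ 0` — an umklapp vertex with `2n` legs is ON SHELL —
if and only if `μ ≥ -2 - 2 cos(π/n)` (`exists_umklapp_iff`).  The two halves:

* `eq_zero_of_sum_eq_reciprocal` — below the threshold every on-shell `2n`-tuple with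
  `Σ kᵢ ∈ 2πℤ²` has `Σ kᵢ = 0` (conservation in `ℝ²` and modulo `2πℤ²` agree), for ANY index type of
  cardinality `2n` and (by `k ↦ -k` symmetry, `eq_zero_of_signed_sum_eq_reciprocal`) any signs; the
  geometric input is `abs_le_arccos_of_sqDispersion_eq`: on the Fermi curve `|kⱼ| ≤ arccos(-μ/2 - 1)`;
* `exists_umklapp_of_threshold_le` — at and above the threshold the explicit configuration
  `kₛᵢ = (π/n, ± b)`, `cos b = -μ/2 - cos(π/n)`, `n` legs of each sign, is on shell and sums to `(2π, 0)`.

Corollaries: `8` legs ⟺ `μ ≥ -2 - √2` (the complement of BGM 2006's hypothesis, cf.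
`HubbardFermiCurve.abs_lt_pi_div_four_of_sqDispersion_eq`), `6` legs ⟺ `μ ≥ -3`, `4` legs ⟺ `μ ≥ -2`,
`2` legs ⟺ `μ = 0` (the nesting vector at half filling); on the window `-2 ≤ μ ≤ 0` of Proposition U
all of `4`-, `6`-, `8`-leg umklapp are on shell (`umklapp_on_shell_of_neg_two_le`).

## 2. The periodic caustic chain at `μ = -1` (memo §2d (3)(iv′))

At `μ = -1` (`μ_BGM = 3/2`) the four rotations `P₀ = (3π/5, π/5)`, `P₁ = (π/5, -3π/5)`,
`P₂ = (-3π/5, -π/5)`, `P₃ = (-π/5, 3π/5)` of the cluster point of Proposition U are all on the Fermi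
curve, strictly inside the zone, and `P_{j+1} + 3 P_j ∈ 2πℤ² ∖ 0` for every `j (mod 4)` with
PERPENDICULAR Fermi velocities at `P_j`, `P_{j+1}`: the anchor of each transverse umklapp quartet
`(P_{j+1}; P_j, P_j, P_j)` is the cluster point of the next — a CLOSED orbit of the anchor map
`k ↦ [-3k]`, i.e. an infinite chain of transverse umklapp caustics (`periodic_umklapp_caustic_chain`;
input `cos_three_pi_div_five : cos(3π/5) = (1 - √5)/4` from Mathlib's `cos(π/5) = (1 + √5)/4`).
The memo shows (algebra, not formalised) that `μ = -1` is the ONLY level in `-2 < μ < 0` with such a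
`(3,3)` double caustic, and (computation) lists the `75` levels carrying double caustics of cluster
orders `≤ 7`.

No new definitions.  New elementary mathematics about the summit's band, hence Summits-side.

## Sources

* G. Benfatto, A. Giuliani, V. Mastropietro, Ann. Henri Poincaré 7 (2006) 809–898
  (arXiv:cond-mat/0507686), Thm. 1.1 (`0 < μ_BGM < (2-√2)/2`), (2.39)–(2.40) and the remark after
  (2.76). [BenfattoGiulianiMastropietro2006]
* G. Benfatto, A. Giuliani, V. Mastropietro, Ann. Henri Poincaré 4 (2003) 137–193
  (arXiv:cond-mat/0207210), Lemma 3.1, (3.44), (3.62). [BenfattoGiulianiMastropietro2003]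
-/

noncomputable section

open Real Set Finset

namespace Summit.HubbardSuperconductivity.HubbardSuperconductivity.Theorems

open Literature.MathematicalPhysics.QuantumLattice

/-! ### 1. Thresholds -/

/-- On the Fermi curve `{ε = μ}` inside the zone `|kᵢ| ≤ π`, each coordinate satisfies
`|kⱼ| ≤ arccos(-μ/2 - 1)` (because `cos kⱼ = -μ/2 - cos k_{j'} ≥ -μ/2 - 1`; for `μ > 0` the bound is
the trivial `π`). -/
theorem abs_le_arccos_of_sqDispersion_eq {μ : ℝ} {k : Fin 2 → ℝ}
    (hk : ∀ i, |k i| ≤ π) (he : sqDispersion k = μ) (j : Fin 2) :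
    |k j| ≤ Real.arccos (-μ / 2 - 1) := by
  have h0 := Real.cos_le_one (k 0)
  have h1 := Real.cos_le_one (k 1)
  unfold sqDispersion at he
  have hcos : -μ / 2 - 1 ≤ Real.cos (|k j|) := by
    rw [Real.cos_abs]
    fin_cases j
    · show -μ / 2 - 1 ≤ Real.cos (k 0); linarith
    · show -μ / 2 - 1 ≤ Real.cos (k 1); linarith
  have habs : Real.arccos (Real.cos |k j|) = |k j| :=
    Real.arccos_cos (abs_nonneg _) (hk j)
  rw [← habs]
  exact Real.arccos_le_arccos hcos

/-- **Below the threshold no umklapp is on shell.**  If `0 < n`, `μ < -2 - 2cos(π/n)` and `2n` zone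
momenta on `{ε = μ}` sum to a reciprocal-lattice vector `2πG`, then `G = 0`. Any index type of
cardinality `2n`. -/
theorem eq_zero_of_sum_eq_reciprocal {μ : ℝ} {n : ℕ} (hn : 0 < n)
    (hμ : μ < -2 - 2 * Real.cos (π / n)) {ι : Type*} [Fintype ι]
    (hcard : Fintype.card ι = 2 * n) (k : ι → Fin 2 → ℝ) (hk : ∀ i j, |k i j| ≤ π)
    (he : ∀ i, sqDispersion (k i) = μ) (G : Fin 2 → ℤ)
    (hsum : ∑ i, k i = fun j => 2 * π * (G j : ℝ)) : G = 0 := by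
  have hπ := Real.pi_pos
  have hnr : (0 : ℝ) < n := by exact_mod_cast hn
  have hcosle : Real.cos (π / n) ≤ 1 := Real.cos_le_one _
  have hcosge : -1 ≤ Real.cos (π / n) := Real.neg_one_le_cos _
  -- ι is nonempty, hence μ ≥ -4
  have hne : Nonempty ι := by
    rw [← Fintype.card_pos_iff, hcard]; omega
  obtain ⟨i₀⟩ := hne
  have hμ4 : -4 ≤ μ := by rw [← he i₀]; exact neg_four_le_sqDispersion _
  -- the arccos bound is < π/n
  have hx1 : -μ / 2 - 1 ≤ 1 := by linarith
  have hxm : Real.cos (π / n) < -μ / 2 - 1 := by linarith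
  have hlt : Real.arccos (-μ / 2 - 1) < π / n := by
    have hmem1 : Real.cos (π / n) ∈ Icc (-1 : ℝ) 1 := ⟨Real.neg_one_le_cos _, hcosle⟩
    have hmem2 : -μ / 2 - 1 ∈ Icc (-1 : ℝ) 1 := ⟨by linarith, hx1⟩
    have h := Real.strictAntiOn_arccos hmem1 hmem2 hxm
    have e0 : (0 : ℝ) ≤ π / n := by positivity
    have e1 : π / n ≤ π := div_le_self hπ.le (by exact_mod_cast hn)
    rwa [Real.arccos_cos e0 e1] at h
  by_contra hG
  obtain ⟨j, hj⟩ : ∃ j, G j ≠ 0 := by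
    by_contra h
    push Not at h
    exact hG (funext h)
  -- |2π G j| ≥ 2π
  have hGj : (1 : ℝ) ≤ |(G j : ℝ)| := by
    rw [← Int.cast_abs]; exact_mod_cast Int.one_le_abs hj
  have hbig : 2 * π ≤ |∑ i, k i j| := by
    have : (∑ i, k i) j = 2 * π * (G j : ℝ) := by rw [hsum]
    rw [Finset.sum_apply] at this
    rw [this, abs_mul, abs_of_pos (by positivity : (0:ℝ) < 2 * π)]
    nlinarith
  -- |Σ| ≤ Σ |k i j| ≤ card * arccos < 2n * π/n = 2π
  have hsmall : |∑ i, k i j| < 2 * π := by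
    calc |∑ i, k i j| ≤ ∑ i, |k i j| := Finset.abs_sum_le_sum_abs _ _
      _ ≤ ∑ _i : ι, Real.arccos (-μ / 2 - 1) :=
          Finset.sum_le_sum fun i _ => abs_le_arccos_of_sqDispersion_eq (hk i) (he i) j
      _ = (2 * n : ℝ) * Real.arccos (-μ / 2 - 1) := by
          rw [Finset.sum_const, Finset.card_univ, hcard, nsmul_eq_mul]; push_cast; ring
      _ < (2 * n : ℝ) * (π / n) := by
          exact mul_lt_mul_of_pos_left hlt (by positivity)
      _ = 2 * π := by field_simp
  linarith

/-- Signed version (the legs of an interaction vertex carry signs `ε(f) = ±1`): below the threshold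
`Σ εᵢ kᵢ ∈ 2πℤ²` forces `Σ εᵢ kᵢ = 0`.  Reduced to the unsigned statement by the symmetry `k ↦ -k`
of the zone and of the level sets. -/
theorem eq_zero_of_signed_sum_eq_reciprocal {μ : ℝ} {n : ℕ} (hn : 0 < n)
    (hμ : μ < -2 - 2 * Real.cos (π / n)) {ι : Type*} [Fintype ι]
    (hcard : Fintype.card ι = 2 * n) (k : ι → Fin 2 → ℝ) (hk : ∀ i j, |k i j| ≤ π)
    (he : ∀ i, sqDispersion (k i) = μ) (ε : ι → ℝ) (hε : ∀ i, ε i = 1 ∨ ε i = -1)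
    (G : Fin 2 → ℤ) (hsum : ∑ i, ε i • k i = fun j => 2 * π * (G j : ℝ)) : G = 0 := by
  refine eq_zero_of_sum_eq_reciprocal hn hμ hcard (fun i => ε i • k i) ?_ ?_ G hsum
  · intro i j
    rcases hε i with h | h <;> simp [h, hk i j]
  · intro i
    rcases hε i with h | h
    · simp [h, he i]
    · rw [← he i]; simp [h, sqDispersion]

/-- **At and above the threshold an umklapp `2n`-tuple exists**: for `0 < n`,
`-2 - 2cos(π/n) ≤ μ ≤ 0`, the momenta `k₍ₛ,ᵢ₎ = (π/n, ±b)` with `cos b = -μ/2 - cos(π/n)` (`n` of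
each sign) lie on `{ε = μ}` inside the zone and sum to the reciprocal vector `(2π, 0)`. -/
theorem exists_umklapp_of_threshold_le {μ : ℝ} {n : ℕ} (hn : 0 < n)
    (hμ₁ : -2 - 2 * Real.cos (π / n) ≤ μ) (hμ₂ : μ ≤ 0) :
    ∃ k : Fin 2 × Fin n → Fin 2 → ℝ,
      (∀ i j, |k i j| ≤ π) ∧ (∀ i, sqDispersion (k i) = μ) ∧ ∑ i, k i = ![2 * π, 0] := by
  have hπ := Real.pi_pos
  have hnr : (0 : ℝ) < n := by exact_mod_cast hn
  set x : ℝ := -μ / 2 - Real.cos (π / n) with hx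
  have hx1 : x ≤ 1 := by rw [hx]; linarith
  have hx0 : -1 ≤ x := by rw [hx]; linarith [Real.cos_le_one (π / n)]
  set b : ℝ := Real.arccos x with hb
  have hcb : Real.cos b = x := Real.cos_arccos hx0 hx1
  have hb0 : 0 ≤ b := Real.arccos_nonneg x
  have hbπ : b ≤ π := Real.arccos_le_pi x
  have hpn0 : 0 < π / n := by positivity
  have hpnπ : π / n ≤ π := div_le_self hπ.le (by exact_mod_cast hn)
  refine ⟨fun p => ![π / n, if p.1 = 0 then b else -b], ?_, ?_, ?_⟩
  · rintro ⟨s, i⟩ j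
    fin_cases j
    · show |π / ↑n| ≤ π
      rw [abs_of_pos hpn0]; exact hpnπ
    · show |if s = 0 then b else -b| ≤ π
      split_ifs
      · rw [abs_of_nonneg hb0]; exact hbπ
      · rw [abs_neg, abs_of_nonneg hb0]; exact hbπ
  · rintro ⟨s, i⟩
    have : Real.cos (if s = 0 then b else -b) = x := by
      split_ifs
      · exact hcb
      · rw [Real.cos_neg, hcb]
    rw [sqDispersion_def_vec, this, hx]; ring
  · rw [Fintype.sum_prod_type]
    simp only [Finset.sum_const, Finset.card_univ, Fintype.card_fin, Fin.sum_univ_two,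
      Fin.isValue]
    ext j
    fin_cases j
    · simp; field_simp; norm_num
    · simp
  where
  /-- local restatement of `sqDispersion` on an explicit vector -/
  sqDispersion_def_vec (a c : ℝ) : sqDispersion ![a, c] = -2 * (Real.cos a + Real.cos c) := by
    simp [sqDispersion]

/-- **Sharp threshold (iff).** For `0 < n` and `μ ≤ 0`: an on-shell `2n`-tuple of zone momenta with
sum in `2πℤ² ∖ 0` exists iff `-2 - 2cos(π/n) ≤ μ`. -/
theorem exists_umklapp_iff {μ : ℝ} {n : ℕ} (hn : 0 < n) (hμ : μ ≤ 0) :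
    (∃ k : Fin 2 × Fin n → Fin 2 → ℝ,
      (∀ i j, |k i j| ≤ π) ∧ (∀ i, sqDispersion (k i) = μ) ∧
      ∃ G : Fin 2 → ℤ, G ≠ 0 ∧ ∑ i, k i = fun j => 2 * π * (G j : ℝ)) ↔
    -2 - 2 * Real.cos (π / n) ≤ μ := by
  constructor
  · rintro ⟨k, hk, he, G, hG, hsum⟩
    by_contra hlt
    push Not at hlt
    exact hG (eq_zero_of_sum_eq_reciprocal hn hlt (by simp) k hk he G hsum)
  · intro h
    obtain ⟨k, hk, he, hsum⟩ := exists_umklapp_of_threshold_le hn h hμ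
    refine ⟨k, hk, he, ![1, 0], by simp, ?_⟩
    rw [hsum]
    ext j
    fin_cases j <;> simp

/-- `8` legs: on shell iff `μ ≥ -2 - √2` — exactly the complement of the hypothesis of BGM 2006,
Thm. 1.1 (`μ < -2 - √2`, where no umklapp with `≤ 8` legs is on shell). -/
theorem exists_eight_leg_umklapp_iff {μ : ℝ} (hμ : μ ≤ 0) :
    (∃ k : Fin 2 × Fin 4 → Fin 2 → ℝ,
      (∀ i j, |k i j| ≤ π) ∧ (∀ i, sqDispersion (k i) = μ) ∧
      ∃ G : Fin 2 → ℤ, G ≠ 0 ∧ ∑ i, k i = fun j => 2 * π * (G j : ℝ)) ↔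
    -2 - Real.sqrt 2 ≤ μ := by
  have h := exists_umklapp_iff (n := 4) (by norm_num) hμ
  have e : Real.cos (π / (4 : ℕ)) = Real.sqrt 2 / 2 := by
    rw [show (π / (4 : ℕ) : ℝ) = π / 4 by norm_num, Real.cos_pi_div_four]
  rw [e] at h
  convert h using 2; ring

/-- `6` legs: on shell iff `μ ≥ -3`. -/
theorem exists_six_leg_umklapp_iff {μ : ℝ} (hμ : μ ≤ 0) :
    (∃ k : Fin 2 × Fin 3 → Fin 2 → ℝ,
      (∀ i j, |k i j| ≤ π) ∧ (∀ i, sqDispersion (k i) = μ) ∧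
      ∃ G : Fin 2 → ℤ, G ≠ 0 ∧ ∑ i, k i = fun j => 2 * π * (G j : ℝ)) ↔
    -3 ≤ μ := by
  have h := exists_umklapp_iff (n := 3) (by norm_num) hμ
  have e : Real.cos (π / (3 : ℕ)) = 1 / 2 := by
    rw [show (π / (3 : ℕ) : ℝ) = π / 3 by norm_num, Real.cos_pi_div_three]
  rw [e] at h
  convert h using 2; norm_num

/-- `4` legs: on shell iff `μ ≥ -2` (the window of Proposition U). -/
theorem exists_four_leg_umklapp_iff {μ : ℝ} (hμ : μ ≤ 0) :
    (∃ k : Fin 2 × Fin 2 → Fin 2 → ℝ,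
      (∀ i j, |k i j| ≤ π) ∧ (∀ i, sqDispersion (k i) = μ) ∧
      ∃ G : Fin 2 → ℤ, G ≠ 0 ∧ ∑ i, k i = fun j => 2 * π * (G j : ℝ)) ↔
    -2 ≤ μ := by
  have h := exists_umklapp_iff (n := 2) (by norm_num) hμ
  have e : Real.cos (π / (2 : ℕ)) = 0 := by
    rw [show (π / (2 : ℕ) : ℝ) = π / 2 by norm_num, Real.cos_pi_div_two]
  rw [e] at h
  convert h using 2; norm_num

/-- `2` legs (nesting): on shell iff `μ = 0`, i.e. only at half filling. -/
theorem exists_two_leg_umklapp_iff {μ : ℝ} (hμ : μ ≤ 0) :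
    (∃ k : Fin 2 × Fin 1 → Fin 2 → ℝ,
      (∀ i j, |k i j| ≤ π) ∧ (∀ i, sqDispersion (k i) = μ) ∧
      ∃ G : Fin 2 → ℤ, G ≠ 0 ∧ ∑ i, k i = fun j => 2 * π * (G j : ℝ)) ↔
    μ = 0 := by
  have h := exists_umklapp_iff (n := 1) (by norm_num) hμ
  have e : Real.cos (π / (1 : ℕ)) = -1 := by
    rw [show (π / (1 : ℕ) : ℝ) = π by norm_num, Real.cos_pi]
  rw [e] at h
  rw [h]; constructor <;> intro h' <;> linarith

/-- On the whole window `-2 ≤ μ ≤ 0` of Proposition U, umklapp with `4`, `6` and `8` legs is on shell. -/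
theorem umklapp_on_shell_of_neg_two_le {μ : ℝ} (h₁ : -2 ≤ μ) (h₂ : μ ≤ 0) {n : ℕ} (hn : 2 ≤ n) :
    ∃ k : Fin 2 × Fin n → Fin 2 → ℝ,
      (∀ i j, |k i j| ≤ π) ∧ (∀ i, sqDispersion (k i) = μ) ∧ ∑ i, k i = ![2 * π, 0] := by
  refine exists_umklapp_of_threshold_le (by omega) ?_ h₂
  have : 0 ≤ Real.cos (π / n) := by
    have hnr : (2 : ℝ) ≤ n := by exact_mod_cast hn
    apply Real.cos_nonneg_of_neg_pi_div_two_le_of_le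
    · have : 0 ≤ π / n := by positivity
      linarith [Real.pi_pos]
    · rw [div_le_div_iff_of_pos_left Real.pi_pos (by positivity) (by norm_num)]
      exact hnr
  linarith

/-! ### 2. The periodic caustic chain at `μ = -1` -/

/-- `cos(3π/5) = (1 - √5)/4` (from Mathlib's `cos(π/5) = (1 + √5)/4`). -/
theorem cos_three_pi_div_five : Real.cos (3 * π / 5) = (1 - Real.sqrt 5) / 4 := by
  have h1 : 3 * π / 5 = π - 2 * (π / 5) := by ring
  rw [h1, Real.cos_pi_sub, Real.cos_two_mul, Real.cos_pi_div_five]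
  have h5 : Real.sqrt 5 ^ 2 = 5 := Real.sq_sqrt (by norm_num)
  nlinarith [h5]

/-- `cos(3π/5) + cos(π/5) = 1/2`: the points `(±3π/5, ±π/5)`, `(±π/5, ±3π/5)` lie on `{ε = -1}`. -/
theorem cos_three_pi_div_five_add_cos_pi_div_five :
    Real.cos (3 * π / 5) + Real.cos (π / 5) = 1 / 2 := by
  rw [cos_three_pi_div_five, Real.cos_pi_div_five]; ring

/-- **The periodic chain of transverse umklapp caustics at `μ = -1`.**  The four rotations
`P₀ = (3π/5, π/5)`, `P₁ = (π/5, -3π/5)`, `P₂ = (-3π/5, -π/5)`, `P₃ = (-π/5, 3π/5)` are pairwise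
distinct points of `{ε = -1}` strictly inside the zone with `P_{j+1} + 3P_j ∈ 2πℤ² ∖ 0` (indices
mod `4`) and perpendicular Fermi velocities `v(P_j) · v(P_{j+1}) = 0`, `v = (2 sin k₁, 2 sin k₂)`:
each `(P_{j+1}; P_j, P_j, P_j)` is an orthogonal umklapp quartet whose anchor is the cluster point of
the next — a closed orbit of the anchor map. -/
theorem periodic_umklapp_caustic_chain :
    ∃ P : Fin 4 → Fin 2 → ℝ,
      Function.Injective P ∧
      (∀ j, sqDispersion (P j) = -1) ∧
      (∀ j i, |P j i| < π) ∧
      (∀ j, ∃ G : Fin 2 → ℤ, G ≠ 0 ∧ P (j + 1) + (3 : ℝ) • P j = fun i => 2 * π * (G i : ℝ)) ∧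
      (∀ j, (2 * Real.sin (P j 0)) * (2 * Real.sin (P (j + 1) 0))
            + (2 * Real.sin (P j 1)) * (2 * Real.sin (P (j + 1) 1)) = 0) := by
  have hπ := Real.pi_pos
  have hc := cos_three_pi_div_five_add_cos_pi_div_five
  refine ⟨![ ![3 * π / 5, π / 5], ![π / 5, -(3 * π / 5)], ![-(3 * π / 5), -(π / 5)],
            ![-(π / 5), 3 * π / 5] ], ?_, ?_, ?_, ?_, ?_⟩
  · -- injective: the first coordinates are pairwise distinct
    intro j j' h
    have h0 := congrFun h 0
    fin_cases j <;> fin_cases j' <;> simp at h0 ⊢ <;> linarith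
  · intro j
    fin_cases j <;> simp [sqDispersion, Real.cos_neg, cos_three_pi_div_five, Real.cos_pi_div_five] <;> ring
  · intro j i
    fin_cases j <;> fin_cases i <;> simp [abs_of_pos, abs_of_neg, hπ] <;> linarith
  · intro j
    fin_cases j
    · refine ⟨![1, 0], by simp, ?_⟩
      ext i; fin_cases i <;> simp <;> ring
    · refine ⟨![0, -1], by simp, ?_⟩
      ext i; fin_cases i <;> simp <;> ring
    · refine ⟨![-1, 0], by simp, ?_⟩
      ext i; fin_cases i <;> simp <;> ring
    · refine ⟨![0, 1], by simp, ?_⟩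
      ext i; fin_cases i <;> simp <;> ring
  · intro j
    fin_cases j <;> simp [Real.sin_neg] <;> ring

end Summit.HubbardSuperconductivity.HubbardSuperconductivity.Theorems
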